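import Summits.ValiantsHypothesis.ValiantsHypothesis.Theorems.BarrierLeverPartitionMinorsPairSplitMixed
import Summits.ValiantsHypothesis.ValiantsHypothesis.Theorems.BarrierLeverTransversalMinorLayoutsLockedComplexes

/-!
# Route BarrierLever — Chow witnesses for partition minors (items 20172 / 20195): the LOCKED-CORE
# ENGINE in height form

Helper file (`--supports stmt-ValiantsHypothesis-20195`; cell valiant-natproofs, rung V4, 𝒟-side of
door (c); seat val-np-p4 gen 10).  Closes NO item.  Conventions of items 19717 / 20172 / 20195: the
layout `(u, w)` of height `h` (`u w : Fin r → Finset (Fin h)`) is HIT when some product of `h + h`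
affine forms has nonsingular partition minor `det[coeff_{E (u i) (w j)} ∏ ℓ]`.

The Chow-witness analogue of `FiniteCheck.tt_height_le_of_lockedCore` (transversal layouts):

* `chow_height_le_of_lockedCore H₀` — if every LOCKED injective layout pair of height `h ≤ H₀` is
  hit (locked: no literal class `{i : (a ∈ u i) = β}` of the rows has the size of a literal class
  `{j : (c ∈ w j) = γ}` of the columns), then EVERY injective layout pair of height `h ≤ H₀` is hit.

Proof: induction on the height.  An unlocked pair has a row class and a column class of equal size;
comparing the classes «`a ∉ u i`» and «`c ∉ w j`» / «`c ∈ w j`» puts it, after re-indexing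
(`Compression.exists_blockPerm`, `chow_hit_of_perm`), into the block form of `chow_pairSplit`
(equal parity) or `chow_pairSplit_mixed` (mixed parity), whose two projected layouts are one height
down and injective (`preimage_succAbove_injective_of_not_mem/of_mem`).  Unlike the transversal case no
reduction to lower-set layouts is available for Chow witnesses, so the core is «all locked injective
pairs»; at height `0` the locked hypothesis is vacuous.

WHAT THIS IS NOT: a reduction principle for finite height slices of CPM; nothing on items 20195 /
20172 / 19717 themselves (they quantify over all large heights), on crux stmt-ValiantsHypothesis-14610,
or on `VP` versus `VNP`.
-/

set_option linter.dupNamespace false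

namespace Summit.ValiantsHypothesis.ValiantsHypothesis.Theorems.BarrierLever.ChowFactor

open Finset MvPolynomial
open Summit.ValiantsHypothesis.ValiantsHypothesis.Theorems.BarrierLever.Compression
  (exists_blockPerm)

noncomputable section

variable {h : ℕ}

/-! ## 1. Projected blocks stay injective -/

/-- Deleting a coordinate avoided by every member of an injective block keeps it injective. -/
theorem preimage_succAbove_injective_of_not_mem {r : ℕ} (a : Fin (h + 1))
    (v : Fin r → Finset (Fin (h + 1))) (hv : Function.Injective v) (ha : ∀ i, a ∉ v i) :
    Function.Injective (fun i => (v i).preimage a.succAbove Fin.succAbove_right_injective.injOn) := by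
  intro i j hij
  apply hv
  rw [eq_map_preimage_succAbove_of_not_mem a (v i) (ha i),
    eq_map_preimage_succAbove_of_not_mem a (v j) (ha j)]
  exact congrArg _ hij

/-- Deleting a coordinate contained in every member of an injective block keeps it injective. -/
theorem preimage_succAbove_injective_of_mem {r : ℕ} (a : Fin (h + 1))
    (v : Fin r → Finset (Fin (h + 1))) (hv : Function.Injective v) (ha : ∀ i, a ∈ v i) :
    Function.Injective (fun i => (v i).preimage a.succAbove Fin.succAbove_right_injective.injOn) := by
  classical
  intro i j hij
  apply hv
  rw [← Finset.insert_erase (ha i), ← Finset.insert_erase (ha j), erase_eq_map_preimage_succAbove,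
    erase_eq_map_preimage_succAbove]
  exact congrArg _ (congrArg _ hij)

/-! ## 2. Literal classes -/

/-- The two literal classes of a coordinate partition the index set. -/
theorem card_filter_mem_add_card_filter_not_mem {r n : ℕ} (v : Fin r → Finset (Fin n)) (a : Fin n) :
    (Finset.univ.filter fun i => a ∈ v i).card + (Finset.univ.filter fun i => a ∉ v i).card = r := by
  classical
  have e := Finset.card_filter_add_card_filter_not (s := (Finset.univ : Finset (Fin r)))
    (fun i => a ∈ v i)
  rw [Finset.card_univ, Fintype.card_fin] at e
  exact e

/-- The class of the literal `(a, β)` is the `∈`-class or the `∉`-class. -/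
theorem card_filter_iff_eq {r n : ℕ} (v : Fin r → Finset (Fin n)) (a : Fin n) (β : Bool) :
    (Finset.univ.filter fun i => (a ∈ v i ↔ β = true)).card =
      if β then (Finset.univ.filter fun i => a ∈ v i).card
      else (Finset.univ.filter fun i => a ∉ v i).card := by
  cases β
  · rw [if_neg Bool.false_ne_true]
    congr 1
    apply Finset.filter_congr
    intro i _
    simp
  · rw [if_pos rfl]
    congr 1
    apply Finset.filter_congr
    intro i _
    simp

/-! ## 3. The engine -/

/-- **LOCKED-CORE ENGINE for Chow witnesses, height form.**  If every locked injective layout pair of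
height `h ≤ H₀` is hit by a product of `h + h` affine forms, then every injective layout pair of height
`h ≤ H₀` is. -/
theorem chow_height_le_of_lockedCore (H₀ : ℕ)
    (core : ∀ (h r : ℕ), h ≤ H₀ → ∀ (u w : Fin r → Finset (Fin h)), Function.Injective u →
      Function.Injective w →
      (∀ (a c : Fin h) (β γ : Bool),
        (Finset.univ.filter fun i => (a ∈ u i ↔ β = true)).card ≠
          (Finset.univ.filter fun j => (c ∈ w j ↔ γ = true)).card) →
      ∃ ℓ : Fin (h + h) → MvPolynomial (Fin (h + h)) ℂ, (∀ q, (ℓ q).totalDegree ≤ 1) ∧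
        (Matrix.of fun i j : Fin r => coeff
          (∑ b ∈ u i, Finsupp.single (Fin.castAdd h b) 1 + ∑ d ∈ w j, Finsupp.single (Fin.natAdd h d) 1)
          (∏ q, ℓ q)).det ≠ 0)
    (h : ℕ) (hh : h ≤ H₀) (r : ℕ) (u w : Fin r → Finset (Fin h)) (hu : Function.Injective u)
    (hw : Function.Injective w) :
    ∃ ℓ : Fin (h + h) → MvPolynomial (Fin (h + h)) ℂ, (∀ q, (ℓ q).totalDegree ≤ 1) ∧
      (Matrix.of fun i j : Fin r => coeff
        (∑ b ∈ u i, Finsupp.single (Fin.castAdd h b) 1 + ∑ d ∈ w j, Finsupp.single (Fin.natAdd h d) 1)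
        (∏ q, ℓ q)).det ≠ 0 := by
  classical
  induction h generalizing r with
  | zero => exact core 0 r hh u w hu hw (fun a => Fin.elim0 a)
  | succ h ih =>
    by_cases hlk : ∀ (a c : Fin (h + 1)) (β γ : Bool),
        (Finset.univ.filter fun i => (a ∈ u i ↔ β = true)).card ≠
          (Finset.univ.filter fun j => (c ∈ w j ↔ γ = true)).card
    · exact core (h + 1) r hh u w hu hw hlk
    push Not at hlk
    obtain ⟨a, c, β, γ, hk⟩ := hlk
    rw [card_filter_iff_eq, card_filter_iff_eq] at hk
    have hua := card_filter_mem_add_card_filter_not_mem u a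
    have hwc := card_filter_mem_add_card_filter_not_mem w c
    -- the class «a ∉ u i» has the size of «c ∉ w j» (equal parity) or of «c ∈ w j» (mixed)
    have key : (Finset.univ.filter fun i => a ∉ u i).card = (Finset.univ.filter fun j => c ∉ w j).card ∨
        (Finset.univ.filter fun i => a ∉ u i).card = (Finset.univ.filter fun j => c ∈ w j).card := by
      cases β <;> cases γ <;> simp only [Bool.false_eq_true, if_false, if_true] at hk <;> omega
    obtain ⟨k₀, hk₀⟩ : ∃ k₀, (Finset.univ.filter fun i => a ∉ u i).card = k₀ := ⟨_, rfl⟩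
    rw [hk₀] at key hua
    obtain ⟨m, hkm⟩ : ∃ m, r = k₀ + m := ⟨r - k₀, by omega⟩
    subst hkm
    obtain ⟨σ, hσ1, hσ2⟩ := exists_blockPerm (Finset.univ.filter fun i => a ∉ u i) hk₀
    have hu0 : ∀ i : Fin k₀, a ∉ u (σ (Fin.castAdd m i)) := fun i => by
      have := hσ1 i
      rw [Finset.mem_filter] at this
      exact this.2
    have hu1 : ∀ i : Fin m, a ∈ u (σ (Fin.natAdd k₀ i)) := fun i => by
      have := hσ2 i
      rw [Finset.mem_filter] at this
      by_contra hna
      exact this ⟨Finset.mem_univ _, hna⟩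
    -- the projected row blocks, injective, one height down
    have hU0 := preimage_succAbove_injective_of_not_mem a (fun i => u (σ (Fin.castAdd m i)))
      (fun i j hij => Fin.castAdd_injective _ _ (σ.injective (hu hij))) hu0
    have hU1 := preimage_succAbove_injective_of_mem a (fun i => u (σ (Fin.natAdd k₀ i)))
      (fun i j hij => Fin.natAdd_injective _ _ (σ.injective (hu hij))) hu1
    rcases key with hkk | hkk
    · -- equal parity: columns «c ∉ w j» first
      obtain ⟨τ, hτ1, hτ2⟩ := exists_blockPerm (Finset.univ.filter fun j => c ∉ w j) hkk.symm
      have hw0 : ∀ j : Fin k₀, c ∉ w (τ (Fin.castAdd m j)) := fun j => by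
        have := hτ1 j
        rw [Finset.mem_filter] at this
        exact this.2
      have hw1 : ∀ j : Fin m, c ∈ w (τ (Fin.natAdd k₀ j)) := fun j => by
        have := hτ2 j
        rw [Finset.mem_filter] at this
        by_contra hnc
        exact this ⟨Finset.mem_univ _, hnc⟩
      have hW0 := preimage_succAbove_injective_of_not_mem c (fun j => w (τ (Fin.castAdd m j)))
        (fun i j hij => Fin.castAdd_injective _ _ (τ.injective (hw hij))) hw0
      have hW1 := preimage_succAbove_injective_of_mem c (fun j => w (τ (Fin.natAdd k₀ j)))
        (fun i j hij => Fin.natAdd_injective _ _ (τ.injective (hw hij))) hw1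
      exact chow_hit_of_perm u w σ τ (chow_pairSplit a c (fun i => u (σ i)) (fun j => w (τ j))
        hu0 hu1 hw0 hw1 (ih (by omega) k₀ _ _ hU0 hW0) (ih (by omega) m _ _ hU1 hW1))
    · -- mixed parity: columns «c ∈ w j» first
      obtain ⟨τ, hτ1, hτ2⟩ := exists_blockPerm (Finset.univ.filter fun j => c ∈ w j) hkk.symm
      have hw0 : ∀ j : Fin k₀, c ∈ w (τ (Fin.castAdd m j)) := fun j => by
        have := hτ1 j
        rw [Finset.mem_filter] at this
        exact this.2
      have hw1 : ∀ j : Fin m, c ∉ w (τ (Fin.natAdd k₀ j)) := fun j => by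
        have := hτ2 j
        rw [Finset.mem_filter] at this
        intro hc
        exact this ⟨Finset.mem_univ _, hc⟩
      have hW0 := preimage_succAbove_injective_of_mem c (fun j => w (τ (Fin.castAdd m j)))
        (fun i j hij => Fin.castAdd_injective _ _ (τ.injective (hw hij))) hw0
      have hW1 := preimage_succAbove_injective_of_not_mem c (fun j => w (τ (Fin.natAdd k₀ j)))
        (fun i j hij => Fin.natAdd_injective _ _ (τ.injective (hw hij))) hw1
      exact chow_hit_of_perm u w σ τ (chow_pairSplit_mixed a c (fun i => u (σ i)) (fun j => w (τ j))
        hu0 hu1 hw0 hw1 (ih (by omega) k₀ _ _ hU0 hW0) (ih (by omega) m _ _ hU1 hW1))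

end

end Summit.ValiantsHypothesis.ValiantsHypothesis.Theorems.BarrierLever.ChowFactor
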